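import Literature.Computability.MetaComplexity.Frege
import Literature.Computability.Complexity.TimeBoundsProofs
import HarnessLib

/-!
# Frege systems: p-simulation is transitive (Cook–Reckhow 1979, §1–2) — the proof

Computability/MetaComplexity support file (theorem-only) containing the discharge
`Literature.Computability.MetaComplexity.FregeSystem.PSimulates.trans_holds` of the named fact
`Literature.Computability.MetaComplexity.FregeSystem.PSimulates.trans` (`MetaComplexity/Frege`):
if the Frege system `F₁` p-simulates `F₂` and `F₂` p-simulates `F₃`, then `F₁` p-simulates `F₃`.

This is the Frege-system form (translations of proofs `List (PropForm ℕ) → List (PropForm ℕ)`,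
polynomial time w.r.t. the string encoding `encodingPropForm.listBool`) and is NOT the
verifier-form fact `Literature.Computability.MetaComplexity.PSimulates.trans` of
`MetaComplexity/ProofSystems`, whose discharge `PSimulates.trans_holds` lives in
`MetaComplexity/ProofSystemsProofs` (there the translation also receives the statement `x`, and
the composite machine has to copy its input); the two declarations only share a short name.

The proof is the one printed after Cook–Reckhow's Def. 1.5 ("compose the translations") and
preserved as the interim proof in `MetaComplexity/Frege`: with `f` translating `F₂`-proofs into
`F₁`-proofs and `g` translating `F₃`-proofs into `F₂`-proofs, `f ∘ g` translates `F₃`-proofs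
into `F₁`-proofs of the same formula, and it is polynomial time by the accepted composition
theorem `Literature.Computability.Complexity.PolyTimeComputable.comp_holds`
(`Complexity/TimeBoundsProofs`: run, copy, run; the composite of two polynomials is a
polynomial).

No new definition, no new named fact.

## References

* S. A. Cook, R. A. Reckhow, *The relative efficiency of propositional proof systems*,
  J. Symbolic Logic 44 (1979), 36–50, §1 (Def. 1.5 and the remark following it), §2.
  [CookReckhow1979]
-/

namespace Literature.Computability.MetaComplexity

open _root_.Computability Complexity

namespace FregeSystem

variable {F₁ F₂ F₃ : FregeSystem}

/-- **Discharge of `FregeSystem.PSimulates.trans`**: p-simulation of Frege systems is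
transitive — compose the proof translations (`f ∘ g`, polynomial time by
`PolyTimeComputable.comp_holds`); an `F₃`-proof of `φ` goes to an `F₂`-proof of `φ` and then to
an `F₁`-proof of `φ`. [cite: CookReckhow1979, §1–2] -/
theorem PSimulates.trans_holds : FregeSystem.PSimulates.trans (F₁ := F₁) (F₂ := F₂) (F₃ := F₃) := by
  rintro ⟨f, hf, hf'⟩ ⟨g, hg, hg'⟩
  exact ⟨f ∘ g, PolyTimeComputable.comp_holds hf hg, fun π φ h => hf' _ _ (hg' π φ h)⟩

/-- Usable form of `PSimulates.trans_holds`: if `F₁` p-simulates `F₂` and `F₂` p-simulates `F₃`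
then `F₁` p-simulates `F₃`. [cite: CookReckhow1979, §1–2] -/
theorem PSimulates.trans' (h₁₂ : F₁.PSimulates F₂) (h₂₃ : F₂.PSimulates F₃) : F₁.PSimulates F₃ :=
  PSimulates.trans_holds h₁₂ h₂₃

end FregeSystem

end Literature.Computability.MetaComplexity
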